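import Literature.Computability.Complexity.MultilinearExtension
import Literature.Computability.Complexity.XorFiberGrowth
import HarnessLib

/-!
# Algebraic queries are rectangles: Aaronson–Wigderson's transfer principle in the transcript model

Topic `Literature/Computability/Complexity` (algebrization). Aaronson–Wigderson, *Algebrization: a
new barrier in complexity theory* (STOC 2008, full version), Thm. 4.11 (p. 22): a machine that
queries the multilinear extension `Ã` of `A = (A₀, A₁)` is simulated, query by query, by a
two-party protocol in which Alice holds `A₀` and Bob holds `A₁`, because
`Ã(y) = Ã₀(y) + Ã₁(y)` is the sum of a part Alice can compute and a part Bob can compute ("Alice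
computes the partial sum `Ã₀(y₁)` … and sends `(y₁, Ã₀(y₁))` to Bob …"). This file proves the
consequence of that simulation which the Fourier-analytic lower bound consumes (file
`XorFiberGrowth.lean`): **the acceptance of a deterministic oracle algorithm, as a function of the
two halves of an additively separable oracle, is constant on the parts of a partition into
boundedly many combinatorial rectangles** (`IsRectSimple`).

* `SepOracle X Y` — an *additively separable* family of oracles: the answer to `y` under the data
  `(R, W)` is `answer y (partA y R) (partB y W)`; `SepOracle.oracle`;
* `SepOracle.transAux` — the *refined transcript* of a run (the list of pairs
  `(partA yⱼ R, partB yⱼ W)`, i.e. the messages of the Aaronson–Wigderson protocol),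
  `SepOracle.replayAux` (the run recomputed from the refined transcript alone),
  `runAux_eq_replayAux`, **`transAux_rect`** (refined transcripts are rectangular: the transcript
  of `(R, W)` and of `(R', W')` agree ⇒ so does that of `(R, W')` — Kushilevitz–Nisan Prop. 1.14),
  `length_transAux_le`, `transAux_bound`;
* **`SepOracle.isRectSimple_accept`**: with parts bounded by `NA`, `NB` and fuel `k`, the
  acceptance indicator `(R, W) ↦ [M accepts]` is a `K`-rectangle function with
  `K = (NA · NB + 1)^{k+1}`;
* the multilinear extension of a *patched* language is separable
  (**`sepOracleML`**, `sepOracleML_oracle`): for a background `A₀` and an injective family of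
  addresses `e : ι × Bool → {0,1}*`, the oracle `y ↦ Ã(y)` of the language `A₀` patched by the bits
  `R : ι → Bool` at the addresses `e (·, 0)` and `W : ι → Bool` at `e (·, 1)`, cut off at query
  length `B`, has `Ã(y) = κ_y + ⟨u_y, R⟩ + ⟨v_y, W⟩` over `𝔽_p` (linearity of `Multilinear.ofCube`),
  with both parts `< 2^{B+1}` (`decodeNat_lt_two_pow_succ`).

Everything is proved; no named facts.

## References

* S. Aaronson, A. Wigderson, *Algebrization: a new barrier in complexity theory*, STOC 2008 (full
  version), Thm. 4.11 and its proof, p. 22 [AaronsonWigderson2008].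
* E. Kushilevitz, N. Nisan, *Communication Complexity*, CUP 1997, §1.2, Prop. 1.13–1.14 (a
  protocol partitions `X × Y` into rectangles; the cross property).
* S. Arora, B. Barak, *Computational Complexity: A Modern Approach*, CUP 2009, §3.4 (oracle
  machines; a run is determined by the answers) [AroraBarak2009].
-/

namespace Literature.Computability.Complexity

open _root_.Computability LowDegree

/-! ### Additively separable oracle families and refined transcripts -/

/-- An **additively separable family of oracles** indexed by pairs `(R, W)`: the answer to the
query `y` is a fixed function of `y`, of a number `partA y R` depending on Alice's half only, and
of a number `partB y W` depending on Bob's half only (for the multilinear extension of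
`A = (A₀, A₁)`: `Ã(y) = Ã₀(y) + Ã₁(y)`). [cite: AaronsonWigderson2008, Thm. 4.11] -/
structure SepOracle (X Y : Type*) where
  /-- Alice's share of the answer to `y`. -/
  partA : List Bool → X → ℕ
  /-- Bob's share of the answer to `y`. -/
  partB : List Bool → Y → ℕ
  /-- The answer to `y` given the two shares. -/
  answer : List Bool → ℕ → ℕ → List Bool

namespace SepOracle

variable {X Y : Type*} {β : Type}

/-- The oracle of the data `(R, W)`. [cite: AaronsonWigderson2008, Thm. 4.11] -/
def oracle (S : SepOracle X Y) (R : X) (W : Y) : Oracle := fun y => S.answer y (S.partA y R) (S.partB y W)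

variable (M : OracleAlg β) (S : SepOracle X Y) (z : List Bool)

/-- **The refined transcript** of the run of `M` on `z` against the oracle of `(R, W)`, continued
from the partial answer list `ans` for at most `k` rounds: the list of pairs of shares
`(partA yⱼ R, partB yⱼ W)` of the successive queries — the messages exchanged in the
Aaronson–Wigderson simulation. [cite: AaronsonWigderson2008, Thm. 4.11] -/
def transAux (R : X) (W : Y) : ℕ → List (List Bool) → List (ℕ × ℕ)
  | 0, _ => []
  | k + 1, ans =>
    match M.step z ans with
    | Sum.inl y => (S.partA y R, S.partB y W) ::
        transAux R W k (ans ++ [S.answer y (S.partA y R) (S.partB y W)])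
    | Sum.inr _ => []

/-- **Replaying a run from a refined transcript**: the step function is fed the answers
reconstructed from the shares. [cite: AaronsonWigderson2008, Thm. 4.11] -/
def replayAux : ℕ → List (List Bool) → List (ℕ × ℕ) → Option β
  | 0, _, _ => none
  | k + 1, ans, τ =>
    match M.step z ans with
    | Sum.inl y =>
      match τ with
      | [] => none
      | ab :: τ' => replayAux k (ans ++ [S.answer y ab.1 ab.2]) τ'
    | Sum.inr b => some b

variable {M S z}

/-- **A run is determined by its refined transcript.** [cite: AroraBarak2009, §3.4] -/
theorem runAux_eq_replayAux (R : X) (W : Y) :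
    ∀ (k : ℕ) (ans : List (List Bool)),
      M.runAux (S.oracle R W) z k ans = replayAux M S z k ans (transAux M S z R W k ans)
  | 0, _ => rfl
  | k + 1, ans => by
    rw [OracleAlg.runAux_succ]
    unfold replayAux transAux
    cases hs : M.step z ans with
    | inl y => exact runAux_eq_replayAux R W k _
    | inr b => rfl

/-- **Refined transcripts are rectangular** (the cross property: if `(R, W)` and `(R', W')` produce
the same refined transcript then so does `(R, W')`; induction on the fuel — equal first messages
give equal first answers, hence the same continuation). [cite: AaronsonWigderson2008, Thm. 4.11] -/
theorem transAux_rect :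
    ∀ (k : ℕ) (ans : List (List Bool)) (R R' : X) (W W' : Y),
      transAux M S z R W k ans = transAux M S z R' W' k ans →
        transAux M S z R W' k ans = transAux M S z R W k ans
  | 0, _, _, _, _, _, _ => rfl
  | k + 1, ans, R, R', W, W', h => by
    unfold transAux at h ⊢
    cases hs : M.step z ans with
    | inr b => rfl
    | inl y =>
      rw [hs] at h
      simp only [List.cons.injEq, Prod.mk.injEq] at h
      obtain ⟨⟨hA, hB⟩, htail⟩ := h
      simp only
      rw [← hB]
      have ih := transAux_rect k (ans ++ [S.answer y (S.partA y R) (S.partB y W)]) R R' W W'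
        (by rw [htail, hA, hB])
      rw [ih]

/-- The refined transcript has at most `k` messages. [folklore] -/
theorem length_transAux_le (R : X) (W : Y) :
    ∀ (k : ℕ) (ans : List (List Bool)), (transAux M S z R W k ans).length ≤ k
  | 0, _ => le_rfl
  | k + 1, ans => by
    unfold transAux
    cases M.step z ans with
    | inl y => exact Nat.succ_le_succ (length_transAux_le R W k _)
    | inr b => exact Nat.zero_le _

/-- Bounded shares give bounded messages. [folklore] -/
theorem transAux_bound {NA NB : ℕ} (hA : ∀ y R, S.partA y R < NA) (hB : ∀ y W, S.partB y W < NB)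
    (R : X) (W : Y) :
    ∀ (k : ℕ) (ans : List (List Bool)), ∀ ab ∈ transAux M S z R W k ans, ab.1 < NA ∧ ab.2 < NB
  | 0, _, ab, h => by simp [transAux] at h
  | k + 1, ans, ab, h => by
    unfold transAux at h
    cases hs : M.step z ans with
    | inr b => rw [hs] at h; simp at h
    | inl y =>
      rw [hs] at h
      simp only [List.mem_cons] at h
      rcases h with rfl | h
      · exact ⟨hA y R, hB y W⟩
      · exact transAux_bound hA hB R W k _ ab h

/-! ### Packaging: the acceptance indicator is a rectangle function -/

/-- Encoding a bounded list of messages of length `≤ k` as a total function on `Fin (k+1)`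
(`none` past the end; residues reduced into `Fin`). [folklore] -/
def encodeTrans (k NA NB : ℕ) (hA : 0 < NA) (hB : 0 < NB) (l : List (ℕ × ℕ)) :
    Fin (k + 1) → Option (Fin NA × Fin NB) :=
  fun i => if h : (i : ℕ) < l.length then
    some (⟨(l[(i : ℕ)]).1 % NA, Nat.mod_lt _ hA⟩, ⟨(l[(i : ℕ)]).2 % NB, Nat.mod_lt _ hB⟩) else none

/-- The encoding is injective on bounded lists of length `≤ k`. [folklore] -/
theorem encodeTrans_injOn {k NA NB : ℕ} (hA : 0 < NA) (hB : 0 < NB) {l l' : List (ℕ × ℕ)}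
    (hl : l.length ≤ k) (hl' : l'.length ≤ k)
    (bl : ∀ ab ∈ l, ab.1 < NA ∧ ab.2 < NB) (bl' : ∀ ab ∈ l', ab.1 < NA ∧ ab.2 < NB)
    (h : encodeTrans k NA NB hA hB l = encodeTrans k NA NB hA hB l') : l = l' := by
  have hpt : ∀ i : Fin (k + 1), encodeTrans k NA NB hA hB l i = encodeTrans k NA NB hA hB l' i :=
    fun i => congrFun h i
  -- equal lengths
  have hlen : l.length = l'.length := by
    by_contra hne
    rcases Nat.lt_or_gt_of_ne hne with hlt | hgt
    · have hi := hpt ⟨l.length, by omega⟩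
      simp only [encodeTrans, lt_irrefl, dif_neg, not_false_eq_true, dif_pos hlt] at hi
      cases hi
    · have hi := hpt ⟨l'.length, by omega⟩
      simp only [encodeTrans, lt_irrefl, dif_neg, not_false_eq_true, dif_pos hgt] at hi
      cases hi
  refine List.ext_getElem hlen fun i hi hi' => ?_
  have hik : i < k + 1 := by omega
  have h1 := hpt ⟨i, hik⟩
  simp only [encodeTrans, dif_pos hi, dif_pos hi', Option.some.injEq, Prod.mk.injEq, Fin.mk.injEq] at h1
  obtain ⟨h1a, h1b⟩ := h1
  have ba := bl _ (List.getElem_mem hi)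
  have bb := bl' _ (List.getElem_mem hi')
  rw [Nat.mod_eq_of_lt ba.1, Nat.mod_eq_of_lt bb.1] at h1a
  rw [Nat.mod_eq_of_lt ba.2, Nat.mod_eq_of_lt bb.2] at h1b
  exact Prod.ext h1a h1b

/-- **The acceptance indicator of a deterministic oracle algorithm against a separable oracle
family with bounded shares is a `K`-rectangle function**, `K = (NA · NB + 1)^{k+1}` for fuel `k`
(Aaronson–Wigderson Thm. 4.11 read through Kushilevitz–Nisan Prop. 1.14: the `≤ K` refined
transcripts partition `X × Y` into rectangles on which the verdict is constant).
[cite: AaronsonWigderson2008, Thm. 4.11] -/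
theorem isRectSimple_accept (M : OracleAlg Bool) (S : SepOracle X Y) (z : List Bool) (k : ℕ)
    {NA NB : ℕ} (hA : ∀ y R, S.partA y R < NA) (hB : ∀ y W, S.partB y W < NB)
    (hA0 : 0 < NA) (hB0 : 0 < NB) :
    IsRectSimple ((NA * NB + 1) ^ (k + 1)) fun (R : X) (W : Y) =>
      (if M.runAux (S.oracle R W) z k [] = some true then (1 : ℝ) else 0) := by
  classical
  set tr : X → Y → (Fin (k + 1) → Option (Fin NA × Fin NB)) :=
    fun R W => encodeTrans k NA NB hA0 hB0 (transAux M S z R W k []) with htr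
  -- the verdict as a function of the refined transcript
  have hconst : ∀ R R' W W', tr R W = tr R' W' →
      M.runAux (S.oracle R W) z k [] = M.runAux (S.oracle R' W') z k [] := by
    intro R R' W W' h
    have heq : transAux M S z R W k [] = transAux M S z R' W' k [] :=
      encodeTrans_injOn hA0 hB0 (length_transAux_le R W k []) (length_transAux_le R' W' k [])
        (transAux_bound hA hB R W k []) (transAux_bound hA hB R' W' k []) h
    rw [runAux_eq_replayAux, runAux_eq_replayAux, heq]
  set c : (Fin (k + 1) → Option (Fin NA × Fin NB)) → ℝ := fun t =>
    if h : ∃ p : X × Y, tr p.1 p.2 = t then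
      (if M.runAux (S.oracle (Classical.choose h).1 (Classical.choose h).2) z k [] = some true then 1 else 0)
    else 0 with hc
  refine ⟨Fin (k + 1) → Option (Fin NA × Fin NB), inferInstance, tr, c, ?_, ?_, ?_, ?_⟩
  · simp [Fintype.card_fin, Fintype.card_option, Fintype.card_prod]
  · intro R R' W W' h
    have heq : transAux M S z R W k [] = transAux M S z R' W' k [] :=
      encodeTrans_injOn hA0 hB0 (length_transAux_le R W k []) (length_transAux_le R' W' k [])
        (transAux_bound hA hB R W k []) (transAux_bound hA hB R' W' k []) h
    simp only [htr]
    rw [transAux_rect k [] R R' W W' heq]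
  · intro t
    simp only [hc]
    split_ifs <;> simp
  · intro R W
    have hex : ∃ p : X × Y, tr p.1 p.2 = tr R W := ⟨(R, W), rfl⟩
    simp only [hc, dif_pos hex]
    rw [hconst _ _ _ _ (Classical.choose_spec hex)]

end SepOracle

/-! ### The size of decoded numbers -/

/-- Mathlib's positive-numeral decoder stays below `2^{|l|+1}`. [folklore] -/
theorem decodePosNum_lt_two_pow_succ : ∀ l : List Bool, ((decodePosNum l : PosNum) : ℕ) < 2 ^ (l.length + 1)
  | [] => by simp [decodePosNum]
  | false :: l => by
    have ih := decodePosNum_lt_two_pow_succ l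
    rw [decodePosNum, PosNum.cast_bit0, List.length_cons, pow_succ]
    omega
  | true :: l => by
    have ih := decodePosNum_lt_two_pow_succ l
    rw [decodePosNum]
    split_ifs with h
    · simp
    · rw [PosNum.cast_bit1, List.length_cons, pow_succ]
      omega

/-- **Mathlib's `decodeNat` stays below `2^{|w|+1}`** (not below `2^{|w|}`: `decodeNat [0] = 2` by
Mathlib's junk convention). [folklore] -/
theorem decodeNat_lt_two_pow_succ (w : List Bool) : decodeNat w < 2 ^ (w.length + 1) := by
  unfold decodeNat decodeNum
  split_ifs with h
  · exact Nat.pos_of_ne_zero (by positivity)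
  · rw [PosNum.cast_to_num, Num.cast_pos]
    exact decodePosNum_lt_two_pow_succ w

/-- **The modulus of an extension query is short**: if `y` decodes to `(p, n, x)` then
`p < 2^{|y|+1}` (`p` is the `decodeNat` of the first component of `y`). [cite: AaronsonWigderson2008, Def. 2.2] -/
theorem modulus_lt_of_decode {y : List Bool} {p n : ℕ} {x : Fin n → ℕ}
    (h : encodingExtQuery.decode y = some ⟨p, n, x⟩) : p < 2 ^ (y.length + 1) := by
  have h1 : sigmaBoolDecode (fun _ => Encoding.sigmaBool encodingNatVec) (decodeNat (boolUnpair y).1)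
      (boolUnpair y).2 = some ⟨p, n, x⟩ := h
  simp only [sigmaBoolDecode, Option.map_eq_some_iff] at h1
  obtain ⟨_, -, h3⟩ := h1
  simp only [Sigma.mk.injEq] at h3
  obtain ⟨rfl, -⟩ := h3
  refine (decodeNat_lt_two_pow_succ _).trans_le (Nat.pow_le_pow_right (by norm_num) ?_)
  have := length_boolUnpair_parts_le y
  omega

/-! ### The multilinear extension of a doubly patched language is separable -/

section Patch

variable {ι : Type*}

/-- **Patching a background language by a double window**: the address `e (i, c)` belongs to the
patched language iff bit `i` of `R` (`c = 0`) resp. of `W` (`c = 1`) is set; all other strings are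
decided by the background `A₀` (the XOR-masked window of the oracle construction: the quantum
machine reads `R i ⊕ W i`). [cite: AaronsonWigderson2008, Thm. 4.11] -/
def dwPatch (A₀ : Language Bool) (e : ι × Bool → List Bool) (R W : ι → Bool) : Language Bool :=
  {s | (∃ i c, e (i, c) = s ∧ (if c then W i else R i) = true) ∨ ((∀ j, e j ≠ s) ∧ s ∈ A₀)}

/-- An address belongs to the patched language iff its window bit is set. [folklore] -/
theorem mem_dwPatch_of_eq {A₀ : Language Bool} {e : ι × Bool → List Bool} (he : Function.Injective e)
    (R W : ι → Bool) (i : ι) (c : Bool) :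
    e (i, c) ∈ dwPatch A₀ e R W ↔ (if c then W i else R i) = true := by
  simp only [dwPatch, ne_eq]
  constructor
  · rintro (⟨i', c', h, hw⟩ | ⟨hne, -⟩)
    · obtain ⟨rfl, rfl⟩ := Prod.mk.inj (he h)
      exact hw
    · exact absurd rfl (hne (i, c))
  · intro hw
    exact Or.inl ⟨i, c, rfl, hw⟩

/-- Off the window, the patched language is the background. [folklore] -/
theorem mem_dwPatch_of_not_mem_range {A₀ : Language Bool} {e : ι × Bool → List Bool} (R W : ι → Bool)
    {s : List Bool} (hs : ∀ j, e j ≠ s) : s ∈ dwPatch A₀ e R W ↔ s ∈ A₀ := by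
  simp only [dwPatch, ne_eq]
  constructor
  · rintro (⟨i', c', h, -⟩ | ⟨-, h⟩)
    · exact absurd h (hs (i', c'))
    · exact h
  · intro h
    exact Or.inr ⟨hs, h⟩

/-- The query-length cut-off of an oracle: queries longer than `B` are answered `[]`. Running a
machine with query bound `B` against the cut-off oracle does not change its run, and makes the
dependence on long queries (which a hypothetical run on other data might ask) trivial.
[cite: BakerGillSolovay1975, §1] -/
def cutLen (B : ℕ) (O : Oracle) : Oracle := fun y => if y.length ≤ B then O y else []

/-- Short queries see through the cut-off. [folklore] -/
theorem cutLen_of_le {B : ℕ} (O : Oracle) {y : List Bool} (hy : y.length ≤ B) : cutLen B O y = O y :=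
  if_pos hy

variable [Fintype ι] (A₀ : Language Bool) (e : ι × Bool → List Bool) (B : ℕ)

/-- The coefficient with which the bit stored at the address `s` enters the value of the multilinear
extension at the decoded point `(p, m, x)`: `δ_s(x)` if `|s| = m`, else `0`. [cite: AaronsonWigderson2008, §4.1] -/
noncomputable def coefML (p m : ℕ) (x : Fin m → ℕ) (s : List Bool) : ZMod p :=
  MvPolynomial.eval (fun j => (x j : ZMod p))
    (Multilinear.ofCube fun a : Fin m → Bool => if List.ofFn a = s then (1 : ZMod p) else 0)

/-- One player's share of the value at `(p, m, x)`: `⟨u, v⟩ = ∑_i δ_{addr i}(x) · v_i`. [cite: AaronsonWigderson2008, Thm. 4.11] -/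
noncomputable def shareML (p m : ℕ) (x : Fin m → ℕ) (addr : ι → List Bool) (v : ι → Bool) : ZMod p :=
  ∑ i, coefML p m x (addr i) * (if v i then 1 else 0)

open Classical in
/-- The background's contribution to the value at `(p, m, x)`. [cite: AaronsonWigderson2008, Thm. 4.11] -/
noncomputable def bgML (p m : ℕ) (x : Fin m → ℕ) : ZMod p :=
  MvPolynomial.eval (fun j => (x j : ZMod p))
    (Multilinear.ofCube fun a : Fin m → Bool =>
      if List.ofFn a ∈ A₀ ∧ ∀ j, e j ≠ List.ofFn a then (1 : ZMod p) else 0)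

/-- **The separable presentation of the multilinear extension of a doubly patched language**
(Aaronson–Wigderson Thm. 4.11, "`Ã(y) = Ã₀(y) + Ã₁(y)`"), cut off at query length `B`: Alice's
share is `⟨u_y, R⟩`, Bob's is `⟨v_y, W⟩` (as residues), and the answer adds the background's
contribution. [cite: AaronsonWigderson2008, Thm. 4.11] -/
noncomputable def sepOracleML : SepOracle (ι → Bool) (ι → Bool) where
  partA y R :=
    match encodingExtQuery.decode y with
    | none => 0
    | some ⟨p, m, x⟩ => if p.Prime ∧ y.length ≤ B then (shareML p m x (fun i => e (i, false)) R).val else 0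
  partB y W :=
    match encodingExtQuery.decode y with
    | none => 0
    | some ⟨p, m, x⟩ => if p.Prime ∧ y.length ≤ B then (shareML p m x (fun i => e (i, true)) W).val else 0
  answer y a b :=
    match encodingExtQuery.decode y with
    | none => []
    | some ⟨p, m, x⟩ =>
      if p.Prime ∧ y.length ≤ B then encodeNat ((bgML A₀ e p m x + a + b : ZMod p).val) else []

variable {A₀ e B}

/-- Alice's share is a residue, hence `< 2^{B+1}`. [folklore] -/
theorem sepOracleML_partA_lt (y : List Bool) (R : ι → Bool) :
    (sepOracleML A₀ e B).partA y R < 2 ^ (B + 1) := by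
  simp only [sepOracleML]
  cases hd : encodingExtQuery.decode y with
  | none => exact Nat.pos_of_ne_zero (by positivity)
  | some q =>
    obtain ⟨p, m, x⟩ := q
    simp only
    split_ifs with h
    · haveI : NeZero p := ⟨h.1.ne_zero⟩
      refine (ZMod.val_lt _).trans_le ?_
      exact (modulus_lt_of_decode hd).le.trans (Nat.pow_le_pow_right (by norm_num) (by omega))
    · exact Nat.pos_of_ne_zero (by positivity)

/-- Bob's share is a residue, hence `< 2^{B+1}`. [folklore] -/
theorem sepOracleML_partB_lt (y : List Bool) (W : ι → Bool) :
    (sepOracleML A₀ e B).partB y W < 2 ^ (B + 1) := by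
  simp only [sepOracleML]
  cases hd : encodingExtQuery.decode y with
  | none => exact Nat.pos_of_ne_zero (by positivity)
  | some q =>
    obtain ⟨p, m, x⟩ := q
    simp only
    split_ifs with h
    · haveI : NeZero p := ⟨h.1.ne_zero⟩
      refine (ZMod.val_lt _).trans_le ?_
      exact (modulus_lt_of_decode hd).le.trans (Nat.pow_le_pow_right (by norm_num) (by omega))
    · exact Nat.pos_of_ne_zero (by positivity)

open Classical in
/-- **The slice indicator of the patched language, split into background and the two windows**
(pointwise, over `𝔽_p`). [cite: AaronsonWigderson2008, Thm. 4.11] -/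
theorem sliceIndicator_dwPatch_eq (he : Function.Injective e) (R W : ι → Bool) (p m : ℕ)
    (a : Fin m → Bool) :
    (if (dwPatch A₀ e R W).sliceFn m a then (1 : ZMod p) else 0) =
      (if List.ofFn a ∈ A₀ ∧ ∀ j, e j ≠ List.ofFn a then (1 : ZMod p) else 0) +
        ∑ i, (if List.ofFn a = e (i, false) then (1 : ZMod p) else 0) * (if R i then 1 else 0) +
        ∑ i, (if List.ofFn a = e (i, true) then (1 : ZMod p) else 0) * (if W i then 1 else 0) := by
  classical
  set s := List.ofFn a with hs
  have hslice : (dwPatch A₀ e R W).sliceFn m a = (dwPatch A₀ e R W).boolIndicator s := rfl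
  rw [hslice]
  by_cases hrange : ∃ j, e j = s
  · obtain ⟨⟨i, c⟩, hic⟩ := hrange
    have hmem := mem_dwPatch_of_eq (A₀ := A₀) he R W i c
    rw [hic] at hmem
    -- background term vanishes
    have hbg : (if s ∈ A₀ ∧ ∀ j, e j ≠ s then (1 : ZMod p) else 0) = 0 := by
      rw [if_neg]; rintro ⟨-, h⟩; exact h (i, c) hic
    -- the sums pick the single matching address
    have hsum : ∀ c' : Bool, ∀ v : ι → Bool,
        ∑ i', (if s = e (i', c') then (1 : ZMod p) else 0) * (if v i' then 1 else 0) =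
          if c = c' then (if v i then 1 else 0) else 0 := by
      intro c' v
      by_cases hcc : c = c'
      · subst hcc
        rw [if_pos rfl, Finset.sum_eq_single i]
        · rw [if_pos hic.symm, one_mul]
        · intro i' _ hi'
          rw [if_neg, zero_mul]
          intro h'
          exact hi' (Prod.mk.inj (he (h'.symm.trans hic.symm))).1
        · intro h; exact absurd (Finset.mem_univ i) h
      · rw [if_neg hcc]
        refine Finset.sum_eq_zero fun i' _ => ?_
        rw [if_neg, zero_mul]
        intro h'
        exact hcc (Prod.mk.inj (he (hic.trans h'))).2
    rw [hbg, hsum false R, hsum true W, zero_add]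
    by_cases hsA : s ∈ dwPatch A₀ e R W
    · rw [(Set.mem_iff_boolIndicator _ _).1 hsA]
      have hv := hmem.1 hsA
      cases c
      · simp only [Bool.false_eq_true, if_false] at hv
        simp [hv]
      · simp only [if_true] at hv
        simp [hv]
    · rw [(Set.notMem_iff_boolIndicator _ _).1 hsA]
      have hv : (if c then W i else R i) ≠ true := fun h => hsA (hmem.2 h)
      cases c
      · simp only [Bool.false_eq_true, if_false, ne_eq, Bool.not_eq_true] at hv
        simp [hv]
      · simp only [if_true, ne_eq, Bool.not_eq_true] at hv
        simp [hv]
  · push Not at hrange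
    have hmem := mem_dwPatch_of_not_mem_range (A₀ := A₀) R W hrange
    have hsumz : ∀ c' : Bool, ∀ v : ι → Bool,
        ∑ i', (if s = e (i', c') then (1 : ZMod p) else 0) * (if v i' then 1 else 0) = 0 := by
      intro c' v
      refine Finset.sum_eq_zero fun i' _ => ?_
      rw [if_neg (fun h => hrange (i', c') h.symm), zero_mul]
    rw [hsumz, hsumz, add_zero, add_zero]
    by_cases hsA : s ∈ A₀
    · rw [(Set.mem_iff_boolIndicator _ _).1 (hmem.2 hsA), if_pos rfl, if_pos ⟨hsA, hrange⟩]
    · rw [(Set.notMem_iff_boolIndicator _ _).1 (fun h => hsA (hmem.1 h)), if_neg Bool.false_ne_true,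
        if_neg (fun h => hsA h.1)]

open Classical in
/-- **The value of the multilinear extension of the patched language splits into the background
and the two shares**: `Ã(p, m, x) = κ + ⟨u, R⟩ + ⟨v, W⟩`. [cite: AaronsonWigderson2008, Thm. 4.11] -/
theorem eval_multilinearExtension_dwPatch (he : Function.Injective e) (R W : ι → Bool) (p : Nat.Primes)
    (m : ℕ) (x : Fin m → ℕ) :
    MvPolynomial.eval (fun j => (x j : ZMod p)) ((multilinearExtension (dwPatch A₀ e R W)).poly p m) =
      bgML A₀ e p m x + shareML p m x (fun i => e (i, false)) R + shareML p m x (fun i => e (i, true)) W := by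
  have hpoly : (multilinearExtension (dwPatch A₀ e R W)).poly p m =
      Multilinear.ofCube (fun a : Fin m → Bool => if (dwPatch A₀ e R W).sliceFn m a then (1 : ZMod p) else 0) := rfl
  rw [hpoly]
  have hfun : (fun a : Fin m → Bool => if (dwPatch A₀ e R W).sliceFn m a then (1 : ZMod p) else 0) =
      (fun a : Fin m → Bool => if List.ofFn a ∈ A₀ ∧ ∀ j, e j ≠ List.ofFn a then (1 : ZMod p) else 0) +
        (∑ i, fun a : Fin m → Bool => (if List.ofFn a = e (i, false) then (1 : ZMod p) else 0) * (if R i then 1 else 0)) +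
        (∑ i, fun a : Fin m → Bool => (if List.ofFn a = e (i, true) then (1 : ZMod p) else 0) * (if W i then 1 else 0)) := by
    funext a
    rw [sliceIndicator_dwPatch_eq he]
    simp only [Pi.add_apply, Finset.sum_apply]
  rw [hfun]
  rw [← Multilinear.ofCubeₗ_apply, map_add, map_add, map_sum, map_sum, map_add, map_add, map_sum, map_sum]
  simp only [Multilinear.ofCubeₗ_apply]
  unfold bgML shareML coefML
  congr 1
  · congr 1
    refine Finset.sum_congr rfl fun i _ => ?_
    rw [show (fun a : Fin m → Bool => (if List.ofFn a = e (i, false) then (1 : ZMod p) else 0) * (if R i then 1 else 0)) =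
      (if R i then (1 : ZMod p) else 0) • (fun a : Fin m → Bool => if List.ofFn a = e (i, false) then (1 : ZMod p) else 0) by
        funext a; simp only [Pi.smul_apply, smul_eq_mul]; ring]
    rw [← Multilinear.ofCubeₗ_apply, map_smul, Multilinear.ofCubeₗ_apply, MvPolynomial.smul_eq_C_mul,
      map_mul, MvPolynomial.eval_C]
    ring
  · refine Finset.sum_congr rfl fun i _ => ?_
    rw [show (fun a : Fin m → Bool => (if List.ofFn a = e (i, true) then (1 : ZMod p) else 0) * (if W i then 1 else 0)) =
      (if W i then (1 : ZMod p) else 0) • (fun a : Fin m → Bool => if List.ofFn a = e (i, true) then (1 : ZMod p) else 0) by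
        funext a; simp only [Pi.smul_apply, smul_eq_mul]; ring]
    rw [← Multilinear.ofCubeₗ_apply, map_smul, Multilinear.ofCubeₗ_apply, MvPolynomial.smul_eq_C_mul,
      map_mul, MvPolynomial.eval_C]
    ring

/-- **The oracle of the separable presentation is the cut-off multilinear-extension oracle of the
patched language.** [cite: AaronsonWigderson2008, Thm. 4.11] -/
theorem sepOracleML_oracle (he : Function.Injective e) (R W : ι → Bool) :
    (sepOracleML A₀ e B).oracle R W = cutLen B (multilinearExtension (dwPatch A₀ e R W)).toOracle := by
  funext y
  simp only [SepOracle.oracle, sepOracleML, cutLen, ExtensionOracle.toOracle]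
  cases hd : encodingExtQuery.decode y with
  | none => simp
  | some q =>
    obtain ⟨p, m, x⟩ := q
    simp only [ExtensionOracle.answer]
    by_cases hy : y.length ≤ B
    · rw [if_pos hy]
      by_cases hp : p.Prime
      · rw [if_pos ⟨hp, hy⟩, if_pos ⟨hp, hy⟩, if_pos ⟨hp, hy⟩, dif_pos hp]
        congr 1
        rw [eval_multilinearExtension_dwPatch he R W ⟨p, hp⟩]
        haveI : NeZero p := ⟨hp.ne_zero⟩
        rw [ZMod.natCast_zmod_val, ZMod.natCast_zmod_val]
      · rw [if_neg (fun h => hp h.1), dif_neg hp]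
    · rw [if_neg hy, if_neg (fun h => hy h.2)]

/-- **Aaronson–Wigderson's transfer principle, rectangle form.** For a deterministic oracle
algorithm `M` with fuel `k` on input `z`, the indicator of acceptance against the cut-off
multilinear-extension oracle of the doubly patched language, as a function of the two windows
`(R, W)`, is a `K`-rectangle function with `K = (4^{B+1} + 1)^{k+1}`. [cite: AaronsonWigderson2008, Thm. 4.11] -/
theorem isRectSimple_accept_multilinearExtension (he : Function.Injective e) (M : OracleAlg Bool)
    (z : List Bool) (k : ℕ) :
    IsRectSimple ((2 ^ (B + 1) * 2 ^ (B + 1) + 1) ^ (k + 1)) fun (R W : ι → Bool) =>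
      (if M.runAux (cutLen B (multilinearExtension (dwPatch A₀ e R W)).toOracle) z k [] = some true
        then (1 : ℝ) else 0) := by
  have h := SepOracle.isRectSimple_accept M (sepOracleML A₀ e B) z k
    (fun y R => sepOracleML_partA_lt y R) (fun y W => sepOracleML_partB_lt y W) (by positivity) (by positivity)
  refine (iff_of_eq ?_).1 h
  congr 1
  funext R W
  rw [sepOracleML_oracle he]

end Patch

end Literature.Computability.Complexity
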